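import Literature.Probability.RandomPlanarGeometry.TwoSidedWholePlaneSLE
import HarnessLib

/-!
# Stationary increments of two-sided whole-plane SLE_κ (Zhan (2021), Cor. 4.7): the self-similarity reduction, and the corrected statement

Topic `Probability/RandomPlanarGeometry`; sequel to `TwoSidedWholePlaneSLE` (kept apart to respect
the 400-line cap of that file). Two things are here.

* **Step 1 of Zhan's proof of Cor. 4.7, proved.** Zhan (2021), proof of Cor. 4.7: "Because of the
  self-similarity of `γ̂₀`, it suffices to show that `ν̂^#_{∞⇌0}` is invariant under the map
  `𝒯₁ : γ̂ ↦ γ̂(· + 1) - γ̂(1)`." At the level of laws on `C(ℝ, ℂ)` this is the elementary identity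
  `reroot s = dilatePath ν s ∘ reroot 1 ∘ dilatePath ν s⁻¹` (`s > 0`) together with the flow property
  `reroot s ∘ reroot (-s) = reroot 0` and `reroot 0 = id` on paths rooted at `0`:
  `isRerootInvariant_of_isSelfSimilar_of_map_reroot_one`. (The remaining step — invariance under
  `𝒯₁` — is the content of the SLE loop measure, Zhan (2021), Thm 4.2 (iv), and is not proved here.)
* **The corrected statement of Cor. 4.7 (stationary increments).** The named fact
  `IsTwoSidedWholePlaneSLENatLaw.map_reroot` of `TwoSidedWholePlaneSLE` is stated over the predicate
  `IsTwoSidedWholePlaneSLEPair`, whose second-arm clause represents "given the first arm, the second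
  arm is a chordal SLE_κ curve in the remaining domain" (Zhan (2021), §2.2) pointwise as
  `η₂ = Φ(η₁) ∘ (SLE_κ trace of W)` with `W` a Brownian path independent of `η₁` and
  `Φ : (ℝ → ℂ) → ℂ → ℂ` an ARBITRARY selector of a uniformizer of the remaining domain. That
  representation pins down the conditional law of the second arm only when the selector is
  *measurable*: the uniformizer is unique up to a dilation `λ(η₁) > 0` of `ℍ`, and on a suitable
  (non-standard) probability space — enlarge the product space `Law(η₁) ⊗ Wiener` by a set of first-arm
  paths of inner measure `0` and outer measure `1`, correlated with the event `{W(1) > 0}` — a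
  non-measurable `λ(η₁)` can be made almost surely equal to a non-constant functional `G(W)` while
  `η₁ ⊥ W` and both marginal laws are kept; then `Φ(η₁) ∘ SLE(W) = φ_{η₁} ∘ SLE(W̃)` with
  `W̃ = G(W) · W(· / G(W)²)` NOT a Brownian motion, so the second arm is, conditionally on the first, no
  longer chordal SLE_κ, although every clause of `IsTwoSidedWholePlaneSLEPair` holds. Consequently the
  class `{μ | IsTwoSidedWholePlaneSLENatLaw κ μ}` is (granted existence) strictly larger than the single
  law `ν̂^#_{∞⇌0}` of Zhan's Cor. 4.7, `IsTwoSidedWholePlaneSLENatLaw.unique` fails, and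
  `IsTwoSidedWholePlaneSLENatLaw.map_reroot` asserts re-rooting invariance for laws the source says
  nothing about (an ergodicity argument for Brownian scaling shows some of them are indeed not
  re-rooting invariant). The correction is minimal: `IsTwoSidedWholePlaneSLEPairMeas` adds the joint
  measurability of the selector `Φ` (then `ω ↦ Φ (η₁ ω) (sleTrace κ (W ω) t)` factors measurably
  through `(η₁, W)`, whose law is `Law(η₁) ⊗ Wiener`, and the conditional law of the second arm given
  the first is chordal SLE_κ in the remaining domain, independently of the selector by the dilation
  invariance of the chordal trace law); `IsTwoSidedWholePlaneSLENatLawMeas` is the natural-law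
  predicate over it, and the corrected statement of Cor. 4.7 (stationary increments) is the named
  fact `IsTwoSidedWholePlaneSLENatLawMeas.map_reroot` below — the RESTATEMENT of the misstated
  `IsTwoSidedWholePlaneSLENatLaw.map_reroot` (same source, same conclusion, faithful class of laws;
  review of the split child, 2026-08-15), which the misstated fact implies
  (`IsTwoSidedWholePlaneSLENatLaw.map_reroot_imp_meas`, `IsTwoSidedWholePlaneSLENatLawMeas.map_reroot_of_natLaw`)
  and which Zhan's Step 1 reduces to invariance under `𝒯₁` given self-similarity
  (`IsTwoSidedWholePlaneSLENatLawMeas.map_reroot_of_map_reroot_one`). It is NOT discharged here: the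
  remaining input is the rooted SLE loop measure and its decomposition (Zhan (2021), the theorem on
  rooted loops, Thm 4.1 (iv) in the arXiv numbering), not in the tree; the un-rooting argument of the
  printed proof is formalised in `UnrootedShiftInvariance`
  (`IsTwoSidedWholePlaneSLENatLawMeas.isRerootInvariant_of_timeSmear`).
  The sibling facts `…NatLaw.exists`, `…NatLaw.unique`, `…NatLaw.map_dilatePath`,
  `…NatLaw.map_reversePath` and the chosen law `twoSidedWholePlaneSLENatLaw` inherit the same defect;
  their corrected forms are NOT vendored here (one fact per proposal), see the TODO at the end of the
  file.

## References

* D. Zhan, *SLE loop measures*, PTRF 179 (2021), arXiv:1702.08026 (arXiv numbering): §2.2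
  (two-sided whole-plane SLE_κ), Cor. 4.7 and its proof (p. 23–24 of the arXiv version), Thm 4.2 (iv).
  [Zhan2021SLELoopMeasures]
-/

noncomputable section

open Set Filter Topology MeasureTheory ProbabilityTheory Complex
open UpperHalfPlane (upperHalfPlaneSet)
open Literature.Probability.RandomPlanarGeometry.RootedCurve (reroot reroot_apply reroot_reroot)
open scoped NNReal Real ENNReal

namespace Literature.Probability.RandomPlanarGeometry

open scoped PathBorel

/-! ### Step 1 of the proof of Cor. 4.7: self-similarity reduces stationarity to `𝒯₁` -/

section Reduction

/-- Conjugating the unit re-rooting `𝒯₁` by the dilation of index `ν` and factor `s > 0` gives the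
re-rooting by natural length `s`: `reroot s = dilatePath ν s ∘ reroot 1 ∘ dilatePath ν s⁻¹`
(pointwise on `C(ℝ, ℂ)`: `s^ν (s^{-ν} γ(s (1 + t/s)) - s^{-ν} γ(s)) = γ(s + t) - γ(s)`). This is the
computation behind "because of the self-similarity of `γ̂₀`, it suffices to show … invariant under
`𝒯₁`" in the proof of Zhan (2021), Cor. 4.7. [cite: Zhan2021SLELoopMeasures, Cor. 4.7] -/
theorem reroot_eq_dilatePath_reroot_one (ν : ℝ) {s : ℝ} (hs : 0 < s) (γ : C(ℝ, ℂ)) :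
    reroot s γ = dilatePath ν s (reroot 1 (dilatePath ν s⁻¹ γ)) := by
  ext t
  have h1 : ((s ^ ν : ℝ) : ℂ) * ((s⁻¹ ^ ν : ℝ) : ℂ) = 1 := by
    rw [← Complex.ofReal_mul, Real.inv_rpow hs.le, mul_inv_cancel₀ (Real.rpow_pos_of_pos hs ν).ne',
      Complex.ofReal_one]
  have h2 : (1 + t / s) / s⁻¹ = s + t := by
    field_simp
  have h3 : (1 : ℝ) / s⁻¹ = s := by
    rw [one_div, inv_inv]
  simp only [reroot_apply, dilatePath_apply, h2, h3, mul_sub, ← mul_assoc, h1, one_mul]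

/-- For `s < 0`, re-rooting by `s` after re-rooting by `-s` is re-rooting by `0` (the flow property
`reroot s ∘ reroot t₀ = reroot (t₀ + s)` of `RootedCurve.reroot_reroot`). [folklore] -/
theorem reroot_comp_reroot_neg (s : ℝ) :
    (reroot s : C(ℝ, ℂ) → C(ℝ, ℂ)) ∘ reroot (-s) = reroot 0 := by
  funext γ
  rw [Function.comp_apply, reroot_reroot, neg_add_cancel]

/-- **Self-similarity reduces stationarity of increments to invariance under `𝒯₁`** (Step 1 of the
proof of Zhan (2021), Cor. 4.7, at the level of laws): a law `μ` on two-sided paths that is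
self-similar of some index `ν` (`IsSelfSimilar ν μ`), carried by paths rooted at `0`, and invariant
under the unit re-rooting `𝒯₁ = reroot 1`, is invariant under every re-rooting `reroot s`, `s ∈ ℝ`:
for `s > 0` by `reroot s = dilatePath ν s ∘ reroot 1 ∘ dilatePath ν s⁻¹`, for `s = 0` because
`reroot 0 = id` on paths rooted at `0`, and for `s < 0` because `reroot s ∘ reroot (-s) = reroot 0`.
[cite: Zhan2021SLELoopMeasures, Cor. 4.7] -/
theorem isRerootInvariant_of_isSelfSimilar_of_map_reroot_one {ν : ℝ} {μ : Measure C(ℝ, ℂ)}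
    (hss : IsSelfSimilar ν μ) (h0 : ∀ᵐ γ ∂μ, γ 0 = 0) (h1 : μ.map (reroot 1) = μ) :
    IsRerootInvariant μ := by
  have hpos : ∀ s : ℝ, 0 < s → μ.map (reroot s) = μ := by
    intro s hs
    have hfun : (reroot s : C(ℝ, ℂ) → C(ℝ, ℂ)) = dilatePath ν s ∘ reroot 1 ∘ dilatePath ν s⁻¹ :=
      funext fun γ ↦ reroot_eq_dilatePath_reroot_one ν hs γ
    rw [hfun, ← Measure.map_map (measurable_dilatePath ν s)
        ((measurable_reroot 1).comp (measurable_dilatePath ν s⁻¹)),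
      ← Measure.map_map (measurable_reroot 1) (measurable_dilatePath ν s⁻¹), hss _ (inv_pos.2 hs), h1,
      hss _ hs]
  have hzero : μ.map (reroot 0) = μ := by
    have hae : (reroot 0 : C(ℝ, ℂ) → C(ℝ, ℂ)) =ᵐ[μ] id := by
      filter_upwards [h0] with γ hγ
      exact reroot_zero_of_apply_zero hγ
    rw [Measure.map_congr hae, Measure.map_id]
  intro s
  rcases lt_trichotomy s 0 with hs | rfl | hs
  · calc μ.map (reroot s) = (μ.map (reroot (-s))).map (reroot s) := by rw [hpos (-s) (neg_pos.2 hs)]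
      _ = μ.map (reroot s ∘ reroot (-s)) := Measure.map_map (measurable_reroot s) (measurable_reroot (-s))
      _ = μ := by rw [reroot_comp_reroot_neg, hzero]
  · exact hzero
  · exact hpos s hs

/-- Paths under a two-sided whole-plane SLE_κ natural law are almost surely rooted at `0`
(`γ 0 = 0` is part of the defining almost-sure clause). [folklore] -/
theorem IsTwoSidedWholePlaneSLENatLaw.ae_apply_zero {κ : ℝ≥0} {μ : Measure C(ℝ, ℂ)}
    (h : IsTwoSidedWholePlaneSLENatLaw κ μ) : ∀ᵐ γ ∂μ, γ 0 = 0 := by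
  obtain ⟨Ω, _, P, η₁, η₂, γ, -, hγ, rfl, hae⟩ := h
  have hmeas : MeasurableSet {x : C(ℝ, ℂ) | x 0 = 0} :=
    (continuous_eval_const (0 : ℝ)).measurable (measurableSet_singleton (0 : ℂ))
  rw [ae_map_iff hγ.aemeasurable hmeas]
  filter_upwards [hae] with ω hω using hω.2.1

/-- **Zhan's reduction for the two-sided whole-plane SLE_κ natural law**: given self-similarity of
index `1/d` (hypothesis `h47 : IsTwoSidedWholePlaneSLENatLaw.map_dilatePath`, the first half of
Zhan (2021), Cor. 4.7), stationarity of the increments of a two-sided whole-plane SLE_κ natural law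
`μ` (`0 < κ < 8`) follows from its invariance under the single map `𝒯₁ = reroot 1`.
[cite: Zhan2021SLELoopMeasures, Cor. 4.7] -/
theorem IsTwoSidedWholePlaneSLENatLaw.isRerootInvariant_of_map_reroot_one
    (h47 : IsTwoSidedWholePlaneSLENatLaw.map_dilatePath) {κ : ℝ≥0} {μ : Measure C(ℝ, ℂ)}
    (hκ : 0 < κ) (hκ' : κ < 8) (h : IsTwoSidedWholePlaneSLENatLaw κ μ)
    (h1 : μ.map (reroot 1) = μ) : IsRerootInvariant μ :=
  isRerootInvariant_of_isSelfSimilar_of_map_reroot_one (h.isSelfSimilar h47 hκ hκ') h.ae_apply_zero h1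

end Reduction

/-! ### The corrected pair and natural-law predicates (measurable uniformizer selector) -/

section Corrected

variable {Ω : Type*} [MeasurableSpace Ω]

/-- **The two arms of a two-sided whole-plane SLE_κ from `∞` to `∞` through `0`, with a MEASURABLE
selector of the uniformizer** (corrected form of `IsTwoSidedWholePlaneSLEPair`; same source, same
clauses, plus `Measurable (Function.uncurry Φ)` for the selector `Φ : (ℝ → ℂ) → ℂ → ℂ`, w.r.t. the
product σ-algebra on paths and the Borel σ-algebra on `ℂ`). Zhan (2021), §2.2: the first arm `η₁` is
a whole-plane SLE_κ(2) curve from `∞` to `0` (the inversion of `IsWholePlaneSLEKappaRho κ 2`), and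
"given the first arm of the curve, the second arm of the curve is a chordal SLE_κ curve from `b` to `a`
in the remaining domain": `η₂ = Φ(η₁) ∘ (SLE_κ trace of W)`, `W` a Brownian path independent of `η₁`,
`Φ(η₁)` (the boundary extension of) a uniformizer `ℍ → Ĉ(η₁; ∞)` with `0 ↦ 0`, `∞ ↦ ∞`
(`IsArmUniformizer`). WHY THE EXTRA CLAUSE: with `Φ` jointly measurable,
`ω ↦ Φ (η₁ ω) (sleTrace κ (W ω) t)` is a measurable function of the independent pair `(η₁, W)`, so the
conditional law of the second arm given the first is `Φ(η₁)_*(chordal SLE_κ in ℍ)`, which does not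
depend on the selector (uniformizers differ by dilations of `ℍ`, under which the chordal trace law is
invariant modulo time change); without it (as in `IsTwoSidedWholePlaneSLEPair`) a non-measurable
selector on a suitably enlarged probability space makes the dilation factor a.s. equal to a functional
of `W`, and the second arm is then driven by a non-Brownian path — see the module docstring.
[cite: Zhan2021SLELoopMeasures, §2.2] -/
def IsTwoSidedWholePlaneSLEPairMeas (κ : ℝ≥0) (P : Measure Ω) (η₁ : Ω → ℝ → ℂ)
    (η₂ : Ω → ℝ≥0 → ℂ) : Prop :=
  (∃ γ : Ω → ℝ → ℂ, IsWholePlaneSLEKappaRho κ 2 P γ ∧ ∀ ω t, η₁ ω t = (γ ω t)⁻¹) ∧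
    (∀ t, Measurable fun ω ↦ η₂ ω t) ∧
    ∃ (W : Ω → ℝ≥0 → ℝ) (Φ : (ℝ → ℂ) → ℂ → ℂ), Measurable W ∧ Measurable (Function.uncurry Φ) ∧
      P.map W = Process.preWienerMeasure ∧ IndepFun η₁ W P ∧
      ∀ᵐ ω ∂P, IsArmUniformizer (η₁ ω) (Φ (η₁ ω)) ∧
        Loewner.IsGeneratedByCurve (sleDriving κ (W ω)) (sleTrace κ (W ω)) ∧
        ∀ t, η₂ ω t = Φ (η₁ ω) (sleTrace κ (W ω) t)

/-- A measurably uniformized two-sided pair is a two-sided pair in the sense of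
`IsTwoSidedWholePlaneSLEPair` (forget the measurability of the selector). [folklore] -/
theorem IsTwoSidedWholePlaneSLEPairMeas.toPair {κ : ℝ≥0} {P : Measure Ω} {η₁ : Ω → ℝ → ℂ}
    {η₂ : Ω → ℝ≥0 → ℂ} (h : IsTwoSidedWholePlaneSLEPairMeas κ P η₁ η₂) :
    IsTwoSidedWholePlaneSLEPair κ P η₁ η₂ := by
  obtain ⟨h₁, h₂, W, Φ, hW, -, hlaw, hind, hae⟩ := h
  exact ⟨h₁, h₂, W, Φ, hW, hlaw, hind, hae⟩

/-- In a measurably uniformized pair the second arm is, coordinatewise, almost surely a jointly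
measurable function of the first arm and the driving path: `η₂ · t = (Φ.uncurry) ∘ (η₁, sleTrace κ W t)`
a.e., with `Function.uncurry Φ` measurable. [folklore] -/
theorem IsTwoSidedWholePlaneSLEPairMeas.exists_measurable_uncurry {κ : ℝ≥0} {P : Measure Ω}
    {η₁ : Ω → ℝ → ℂ} {η₂ : Ω → ℝ≥0 → ℂ} (h : IsTwoSidedWholePlaneSLEPairMeas κ P η₁ η₂) :
    ∃ (W : Ω → ℝ≥0 → ℝ) (Φ : (ℝ → ℂ) → ℂ → ℂ), Measurable W ∧ Measurable (Function.uncurry Φ) ∧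
      P.map W = Process.preWienerMeasure ∧ IndepFun η₁ W P ∧
      ∀ t, (fun ω ↦ η₂ ω t) =ᵐ[P] fun ω ↦ Function.uncurry Φ (η₁ ω, sleTrace κ (W ω) t) := by
  obtain ⟨-, -, W, Φ, hW, hΦ, hlaw, hind, hae⟩ := h
  refine ⟨W, Φ, hW, hΦ, hlaw, hind, fun t ↦ ?_⟩
  filter_upwards [hae] with ω hω using hω.2.2 t

/-- **The law of two-sided whole-plane SLE_κ from `∞` to `∞` through `0` in its natural
parametrisation, corrected form** (`IsTwoSidedWholePlaneSLENatLaw` with the pair predicate replaced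
by `IsTwoSidedWholePlaneSLEPairMeas`): `μ` is the law of a random two-sided path `γ̂` which, almost
surely, is parametrised by `(1 + κ/8)`-dimensional Minkowski content, is rooted at `γ̂(0) = 0`, and
traces the second arm on `[0, ∞)` and the first arm on `(-∞, 0)` through increasing time changes.
Zhan (2021), §2.2 (the law `ν^#_{∞⇌0}`), Lemma 2.12 and Cor. 4.7 (the Minkowski content
parametrisation `γ̂₀ = 𝒫(γ)` with `γ̂₀(0) = 0`, defined on `ℝ`). [cite: Zhan2021SLELoopMeasures, §2.2 / Cor. 4.7] -/
def IsTwoSidedWholePlaneSLENatLawMeas (κ : ℝ≥0) (μ : Measure C(ℝ, ℂ)) : Prop :=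
  ∃ (Ω : Type) (_ : MeasurableSpace Ω) (P : Measure Ω) (η₁ : Ω → ℝ → ℂ) (η₂ : Ω → ℝ≥0 → ℂ)
    (γ : Ω → C(ℝ, ℂ)), IsTwoSidedWholePlaneSLEPairMeas κ P η₁ η₂ ∧ Measurable γ ∧ μ = P.map γ ∧
      ∀ᵐ ω ∂P, IsNaturallyParametrized (1 + (κ : ℝ) / 8) (γ ω) ∧ γ ω 0 = 0 ∧
        (∃ e : ℝ≥0 ≃o ℝ≥0, ∀ t : ℝ≥0, γ ω t = η₂ ω (e t)) ∧
        (∃ e' : Iio (0 : ℝ) ≃o ℝ, ∀ t : Iio (0 : ℝ), γ ω t = η₁ ω (e' t))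

/-- A corrected natural law is a natural law in the sense of `IsTwoSidedWholePlaneSLENatLaw`
(the corrected class is contained in the original one). [folklore] -/
theorem IsTwoSidedWholePlaneSLENatLawMeas.toNatLaw {κ : ℝ≥0} {μ : Measure C(ℝ, ℂ)}
    (h : IsTwoSidedWholePlaneSLENatLawMeas κ μ) : IsTwoSidedWholePlaneSLENatLaw κ μ := by
  obtain ⟨Ω, _, P, η₁, η₂, γ, hpair, hγ, hμ, hae⟩ := h
  exact ⟨Ω, _, P, η₁, η₂, γ, hpair.toPair, hγ, hμ, hae⟩

/-- A corrected natural law is a probability measure. [folklore] -/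
theorem IsTwoSidedWholePlaneSLENatLawMeas.isProbabilityMeasure {κ : ℝ≥0} {μ : Measure C(ℝ, ℂ)}
    (h : IsTwoSidedWholePlaneSLENatLawMeas κ μ) : IsProbabilityMeasure μ :=
  h.toNatLaw.isProbabilityMeasure

/-- Paths under a corrected natural law are almost surely rooted at `0`. [folklore] -/
theorem IsTwoSidedWholePlaneSLENatLawMeas.ae_apply_zero {κ : ℝ≥0} {μ : Measure C(ℝ, ℂ)}
    (h : IsTwoSidedWholePlaneSLENatLawMeas κ μ) : ∀ᵐ γ ∂μ, γ 0 = 0 :=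
  h.toNatLaw.ae_apply_zero

/-- **Stationary increments of the two-sided whole-plane SLE_κ natural parametrisation** (named
fact; Zhan's Corollary 4.7, second half, over the faithful class of laws — the RESTATEMENT of the
misstated `IsTwoSidedWholePlaneSLENatLaw.map_reroot` of `TwoSidedWholePlaneSLE`). Zhan (2021),
Cor. 4.7: "Suppose that `γ̂₀` is a Minkowski content parametrization of a two-sided whole-plane SLE_κ
curve from `∞` to `∞` passing through `0` such that `γ̂₀(0) = 0`. Then `γ̂₀` is a self-similar
process of index `1/d` defined on `ℝ` with stationary increments" — standing assumptions of §2.1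
("Throughout, we fix `κ ∈ (0, 8)`. Let `d = 1 + κ/8`"); the law of `γ̂₀` is Zhan's `ν̂^#_{∞⇌0}`,
here any `μ` with `IsTwoSidedWholePlaneSLENatLawMeas κ μ` (the law of the `(1 + κ/8)`-Minkowski-content
parametrisation, rooted at `0`, of a two-sided whole-plane SLE_κ pair with measurably uniformized
second arm); "stationary increments" of a process `γ̂₀` on `ℝ` with `γ̂₀(0) = 0` = invariance of its
law under `𝒯_s : γ̂ ↦ γ̂(s + ·) - γ̂(s)` = `reroot s` (`RootedCurve.reroot_apply`), every `s ∈ ℝ`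
(Zhan's proof: invariance under `𝒯₁`, whence under every `𝒯_s` by the self-similarity — Step 1,
`isRerootInvariant_of_isSelfSimilar_of_map_reroot_one`). Only the stationarity half is stated here;
the self-similarity half is the conclusion of `IsTwoSidedWholePlaneSLENatLaw.map_dilatePath_imp_meas`
(`TwoSidedWholePlaneSLEScaling`). NOT discharged: Zhan's proof rests on the rooted SLE_κ loop
measure `μ¹_∞` and its decomposition `μ¹_∞(dγ) ⊗ ℳ_γ(dz) = ν^#_{∞⇌z}(dγ) ⊗ m²(dz)` (the theorem
on rooted loops, Thm 4.1 (iv) in the arXiv numbering), which the tree does not have; everything after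
that input is proved (`UnrootedShiftInvariance`:
`IsTwoSidedWholePlaneSLENatLawMeas.isRerootInvariant_of_timeSmear`).
Relation to the misstated fact: `IsTwoSidedWholePlaneSLENatLaw.map_reroot` asserts the same
conclusion over the larger class `IsTwoSidedWholePlaneSLENatLaw κ` (non-measurable uniformizer
selector), which granted existence is not the singleton `{ν̂^#_{∞⇌0}}` (module docstring); it implies
this fact (`IsTwoSidedWholePlaneSLENatLawMeas.map_reroot_of_natLaw`), not conversely.
[cite: Zhan2021SLELoopMeasures, Cor. 4.7] -/
def IsTwoSidedWholePlaneSLENatLawMeas.map_reroot : Prop :=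
  ∀ (κ : ℝ≥0) (μ : Measure C(ℝ, ℂ)), 0 < κ → κ < 8 → IsTwoSidedWholePlaneSLENatLawMeas κ μ →
    ∀ s : ℝ, μ.map (reroot s) = μ

/-- **The misstated fact implies the corrected one** (the corrected class of laws is smaller,
`IsTwoSidedWholePlaneSLENatLawMeas.toNatLaw`): the conclusion of this theorem is, verbatim, the named
fact `IsTwoSidedWholePlaneSLENatLawMeas.map_reroot` (Zhan (2021), Cor. 4.7, stationary increments,
over the faithful class). DISCREPANCY: the hypothesis `IsTwoSidedWholePlaneSLENatLaw.map_reroot`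
carries the same conclusion over the larger class `IsTwoSidedWholePlaneSLENatLaw κ` (non-measurable
uniformizer selector allowed), which — granted existence of the two-sided curve — contains laws other
than Zhan's `ν̂^#_{∞⇌0}`; it is thus stronger than the source (and fails for some of those laws, see the
module docstring). [cite: Zhan2021SLELoopMeasures, Cor. 4.7] -/
theorem IsTwoSidedWholePlaneSLENatLaw.map_reroot_imp_meas
    (h47 : IsTwoSidedWholePlaneSLENatLaw.map_reroot) :
    ∀ (κ : ℝ≥0) (μ : Measure C(ℝ, ℂ)), 0 < κ → κ < 8 → IsTwoSidedWholePlaneSLENatLawMeas κ μ →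
      ∀ s : ℝ, μ.map (reroot s) = μ :=
  fun κ μ hκ hκ' h ↦ h47 κ μ hκ hκ' h.toNatLaw

/-- The misstated fact `IsTwoSidedWholePlaneSLENatLaw.map_reroot` implies its restatement
`IsTwoSidedWholePlaneSLENatLawMeas.map_reroot` (restriction to the faithful class).
[cite: Zhan2021SLELoopMeasures, Cor. 4.7] -/
theorem IsTwoSidedWholePlaneSLENatLawMeas.map_reroot_of_natLaw
    (h47 : IsTwoSidedWholePlaneSLENatLaw.map_reroot) : IsTwoSidedWholePlaneSLENatLawMeas.map_reroot :=
  IsTwoSidedWholePlaneSLENatLaw.map_reroot_imp_meas h47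

/-- Given Zhan's Corollary 4.7 in its corrected form (hypothesis
`h47 : IsTwoSidedWholePlaneSLENatLawMeas.map_reroot`), every law of the faithful class (`0 < κ < 8`)
is re-rooting invariant (`IsRerootInvariant`, the law predicate of `NaturalParametrization`).
[cite: Zhan2021SLELoopMeasures, Cor. 4.7] -/
theorem IsTwoSidedWholePlaneSLENatLawMeas.isRerootInvariant
    (h47 : IsTwoSidedWholePlaneSLENatLawMeas.map_reroot) {κ : ℝ≥0} {μ : Measure C(ℝ, ℂ)}
    (hκ : 0 < κ) (hκ' : κ < 8) (h : IsTwoSidedWholePlaneSLENatLawMeas κ μ) : IsRerootInvariant μ :=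
  h47 κ μ hκ hκ' h

/-- **Zhan's reduction, corrected class**: a corrected natural law that is self-similar of some index
and invariant under `𝒯₁ = reroot 1` has stationary increments (Step 1 of the proof of Cor. 4.7; the
self-similarity is the other half of Cor. 4.7 and is taken as the hypothesis `hss`).
[cite: Zhan2021SLELoopMeasures, Cor. 4.7] -/
theorem IsTwoSidedWholePlaneSLENatLawMeas.isRerootInvariant_of_map_reroot_one {κ : ℝ≥0}
    {μ : Measure C(ℝ, ℂ)} (h : IsTwoSidedWholePlaneSLENatLawMeas κ μ) {ν : ℝ} (hss : IsSelfSimilar ν μ)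
    (h1 : μ.map (reroot 1) = μ) : IsRerootInvariant μ :=
  isRerootInvariant_of_isSelfSimilar_of_map_reroot_one hss h.ae_apply_zero h1

/-- **Step 1 of Zhan's proof of Cor. 4.7, for the named fact**: "Because of the self-similarity of
`γ̂₀`, it suffices to show that `ν̂^#_{∞⇌0}` is invariant under the map `𝒯₁ : γ̂ ↦ γ̂(· + 1) - γ̂(1)`"
— granted the self-similarity half of Cor. 4.7 on the faithful class (hypothesis `hss`, in the
expanded form of the conclusion of `IsTwoSidedWholePlaneSLENatLaw.map_dilatePath_imp_meas`),
invariance of every faithful law under `reroot 1` (hypothesis `h1`, the SLE-loop-measure content of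
the proof) gives `IsTwoSidedWholePlaneSLENatLawMeas.map_reroot`. [cite: Zhan2021SLELoopMeasures, Cor. 4.7] -/
theorem IsTwoSidedWholePlaneSLENatLawMeas.map_reroot_of_map_reroot_one
    (hss : ∀ (κ : ℝ≥0) (μ : Measure C(ℝ, ℂ)), 0 < κ → κ < 8 →
      IsTwoSidedWholePlaneSLENatLawMeas κ μ →
        ∀ a : ℝ, 0 < a → μ.map (dilatePath (1 / (1 + (κ : ℝ) / 8)) a) = μ)
    (h1 : ∀ (κ : ℝ≥0) (μ : Measure C(ℝ, ℂ)), 0 < κ → κ < 8 →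
      IsTwoSidedWholePlaneSLENatLawMeas κ μ → μ.map (reroot 1) = μ) :
    IsTwoSidedWholePlaneSLENatLawMeas.map_reroot :=
  fun κ μ hκ hκ' h ↦ h.isRerootInvariant_of_map_reroot_one (hss κ μ hκ hκ' h) (h1 κ μ hκ hκ' h)

/-- Conversely, the named fact contains invariance under `𝒯₁ = reroot 1` (its case `s = 1`), so
that — granted self-similarity — corrected stationarity is EQUIVALENT to `𝒯₁`-invariance of every
faithful law, the form in which Zhan proves it. [cite: Zhan2021SLELoopMeasures, Cor. 4.7] -/
theorem IsTwoSidedWholePlaneSLENatLawMeas.map_reroot_iff_map_reroot_one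
    (hss : ∀ (κ : ℝ≥0) (μ : Measure C(ℝ, ℂ)), 0 < κ → κ < 8 →
      IsTwoSidedWholePlaneSLENatLawMeas κ μ →
        ∀ a : ℝ, 0 < a → μ.map (dilatePath (1 / (1 + (κ : ℝ) / 8)) a) = μ) :
    IsTwoSidedWholePlaneSLENatLawMeas.map_reroot ↔
      ∀ (κ : ℝ≥0) (μ : Measure C(ℝ, ℂ)), 0 < κ → κ < 8 →
        IsTwoSidedWholePlaneSLENatLawMeas κ μ → μ.map (reroot 1) = μ :=
  ⟨fun h47 κ μ hκ hκ' h ↦ h47 κ μ hκ hκ' h 1,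
    IsTwoSidedWholePlaneSLENatLawMeas.map_reroot_of_map_reroot_one hss⟩

end Corrected

/- TODO(corrections of the sibling facts of `TwoSidedWholePlaneSLE`, not vendored here — one fact per
proposal): to be restated over `IsTwoSidedWholePlaneSLENatLawMeas`: `exists`
(∀ κ, 0 < κ → κ < 8 → ∃ μ, IsTwoSidedWholePlaneSLENatLawMeas κ μ), `unique` (two `…NatLawMeas κ` laws
coincide — the un-corrected `unique` is false granted existence), `map_dilatePath` (self-similarity of
index `1/(1 + κ/8)`, the conclusion of `IsTwoSidedWholePlaneSLENatLaw.map_dilatePath_imp_meas`),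
`map_reversePath` (reversibility); and the chosen law `twoSidedWholePlaneSLENatLaw κ` should choose
inside the corrected class. The misstated originals stay declared (other files and the ledger reference
them) and are flagged in their docstrings. -/

end Literature.Probability.RandomPlanarGeometry
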